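import Summits.CriticalPhenomena.PercolationContinuityZ3.Theorems.PercNearOneGluingNoHeavyLowerTailAPLProfileEdgeStep
import HarnessLib

/-!
# `NoHeavyLowerTail` (stmt-CriticalPhenomena-4575) — ROW Π in product form for a glued apex set (proof of APL-P for all finite weighted graphs, step 2)

Support file (prover prim-ineq-gen-8 gen 37; `--supports stmt-CriticalPhenomena-4575`; memo
run/shared/lean/prim/prim-ineq-gen-8/FINDING-gen37-APL-PROOF.md §2).  No definitions, no named facts, no sorries.

With the isolation events of a glued apex set `S` and targets `b, c` (`U_S = {¬S~b,¬S~c,b↮c}`, `B_S = {¬S~b,b↮c}`, `C_S = {¬S~c,b↮c}`),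
`X₀ = μ(X_S)`, `X₁ = μ(X_{S∪{t}})` under one `prodBernoulli w`:
* `rowPi_glued` — **`U₀·((B₀−B₁)C₀ + (C₀−C₁)B₀) ≤ (U₀−U₁)·B₀C₀`**, i.e. `π₀ ≥ π_B + π_C` for the conditional pivotalities of `t`;
  from the two BHK 2006 instances `rowPi_b_cov` (for `b` and, by symmetry, for `c`) and measure bookkeeping
  (`B₀ − B₁ = μ(B_S ∩ {t↔b})`, `U₀ − U₁ = μ(U_S ∩ {t↔b}) + μ(U_S ∩ {t↔c})`, …).
This is the hypothesis (Π) of LEMMA Q (`profile_edge_mixture`). [this work]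
-/

noncomputable section

namespace Summit.CriticalPhenomena.PercolationContinuityZ3.Theorems

namespace APL

open MeasureTheory Set Literature.Probability.Percolation Literature.Probability.LatticeModels
open Literature.Probability.Percolation.KNPreFKG (openConn_symm)
open scoped Classical

variable {V : Type*} [Fintype V]

/-! ### ROW Π in product form -/

omit [Fintype V] in
/-- On `{b ↮ c}`, `t ↔ b` and `t ↔ c` are incompatible. [folklore] -/
theorem notConn_tb_tc (t b c : V) (ω : BondConfig V) (hbc : ω ∉ (openConn b c : Set (BondConfig V)))
    (htb : ω ∈ (openConn t b : Set (BondConfig V))) : ω ∉ (openConn t c : Set (BondConfig V)) :=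
  fun htc => hbc (SimpleGraph.Reachable.trans (SimpleGraph.Reachable.symm htb) htc)

set_option maxHeartbeats 1600000 in
/-- **ROW Π** (memo §2) for a glued apex set `S`, a vertex `t` and the targets `b, c`, all probabilities under the same `prodBernoulli w`:
with `X₀ = μ(X_S)`, `X₁ = μ(X_{S ∪ {t}})`,  `U₀·((B₀−B₁)C₀ + (C₀−C₁)B₀) ≤ (U₀−U₁)·B₀C₀`. [this work] -/
theorem rowPi_glued (w : Sym2 V → unitInterval) (S : Finset V) (t b c : V) :
    (prodBernoulli w).real ((⋃ u ∈ (↑S : Set V), (openConn u b : Set (BondConfig V)))ᶜ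
        ∩ (⋃ u ∈ (↑S : Set V), (openConn u c : Set (BondConfig V)))ᶜ ∩ (openConn b c : Set (BondConfig V))ᶜ) *
      (((prodBernoulli w).real ((⋃ u ∈ (↑S : Set V), (openConn u b : Set (BondConfig V)))ᶜ ∩ (openConn b c : Set (BondConfig V))ᶜ)
          - (prodBernoulli w).real ((⋃ u ∈ insert t (↑S : Set V), (openConn u b : Set (BondConfig V)))ᶜ
              ∩ (openConn b c : Set (BondConfig V))ᶜ))
          * (prodBernoulli w).real ((⋃ u ∈ (↑S : Set V), (openConn u c : Set (BondConfig V)))ᶜ ∩ (openConn b c : Set (BondConfig V))ᶜ)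
        + ((prodBernoulli w).real ((⋃ u ∈ (↑S : Set V), (openConn u c : Set (BondConfig V)))ᶜ ∩ (openConn b c : Set (BondConfig V))ᶜ)
          - (prodBernoulli w).real ((⋃ u ∈ insert t (↑S : Set V), (openConn u c : Set (BondConfig V)))ᶜ
              ∩ (openConn b c : Set (BondConfig V))ᶜ))
          * (prodBernoulli w).real ((⋃ u ∈ (↑S : Set V), (openConn u b : Set (BondConfig V)))ᶜ ∩ (openConn b c : Set (BondConfig V))ᶜ)) ≤
    ((prodBernoulli w).real ((⋃ u ∈ (↑S : Set V), (openConn u b : Set (BondConfig V)))ᶜ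
        ∩ (⋃ u ∈ (↑S : Set V), (openConn u c : Set (BondConfig V)))ᶜ ∩ (openConn b c : Set (BondConfig V))ᶜ)
      - (prodBernoulli w).real ((⋃ u ∈ insert t (↑S : Set V), (openConn u b : Set (BondConfig V)))ᶜ
        ∩ (⋃ u ∈ insert t (↑S : Set V), (openConn u c : Set (BondConfig V)))ᶜ ∩ (openConn b c : Set (BondConfig V))ᶜ)) *
      (prodBernoulli w).real ((⋃ u ∈ (↑S : Set V), (openConn u b : Set (BondConfig V)))ᶜ ∩ (openConn b c : Set (BondConfig V))ᶜ) *
      (prodBernoulli w).real ((⋃ u ∈ (↑S : Set V), (openConn u c : Set (BondConfig V)))ᶜ ∩ (openConn b c : Set (BondConfig V))ᶜ) := by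
  set μ := prodBernoulli w with hμ
  set Sb : Set (BondConfig V) := ⋃ u ∈ (↑S : Set V), (openConn u b : Set (BondConfig V)) with hSb
  set Sc : Set (BondConfig V) := ⋃ u ∈ (↑S : Set V), (openConn u c : Set (BondConfig V)) with hSc
  set BC : Set (BondConfig V) := (openConn b c : Set (BondConfig V)) with hBC
  set Tb : Set (BondConfig V) := (openConn t b : Set (BondConfig V)) with hTb
  set Tc : Set (BondConfig V) := (openConn t c : Set (BondConfig V)) with hTc
  have hIb : (⋃ u ∈ insert t (↑S : Set V), (openConn u b : Set (BondConfig V))) = Tb ∪ Sb := biUnion_insert _ _ _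
  have hIc : (⋃ u ∈ insert t (↑S : Set V), (openConn u c : Set (BondConfig V))) = Tc ∪ Sc := biUnion_insert _ _ _
  rw [hIb, hIc]
  -- names for the numbers
  set U0 := μ.real (Sbᶜ ∩ Scᶜ ∩ BCᶜ) with hU0
  set B0 := μ.real (Sbᶜ ∩ BCᶜ) with hB0
  set C0 := μ.real (Scᶜ ∩ BCᶜ) with hC0
  set mb := μ.real (Sbᶜ ∩ Scᶜ ∩ BCᶜ ∩ Tb) with hmb
  set mc := μ.real (Sbᶜ ∩ Scᶜ ∩ BCᶜ ∩ Tc) with hmc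
  -- (i) the decrements
  have dB : μ.real ((Tb ∪ Sb)ᶜ ∩ BCᶜ) = B0 - μ.real (Sbᶜ ∩ BCᶜ ∩ Tb) := by
    have h := ClusterCovTransfer.real_eq_inter_add_inter_compl w (Sbᶜ ∩ BCᶜ) Tb
    have e : Sbᶜ ∩ BCᶜ ∩ Tbᶜ = (Tb ∪ Sb)ᶜ ∩ BCᶜ := by
      ext ω; simp only [mem_inter_iff, mem_compl_iff, mem_union]; tauto
    rw [← e]; rw [← hμ] at h; linarith
  have dC : μ.real ((Tc ∪ Sc)ᶜ ∩ BCᶜ) = C0 - μ.real (Scᶜ ∩ BCᶜ ∩ Tc) := by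
    have h := ClusterCovTransfer.real_eq_inter_add_inter_compl w (Scᶜ ∩ BCᶜ) Tc
    have e : Scᶜ ∩ BCᶜ ∩ Tcᶜ = (Tc ∪ Sc)ᶜ ∩ BCᶜ := by
      ext ω; simp only [mem_inter_iff, mem_compl_iff, mem_union]; tauto
    rw [← e]; rw [← hμ] at h; linarith
  have dU : μ.real ((Tb ∪ Sb)ᶜ ∩ (Tc ∪ Sc)ᶜ ∩ BCᶜ) = U0 - mb - mc := by
    have h1 := ClusterCovTransfer.real_eq_inter_add_inter_compl w (Sbᶜ ∩ Scᶜ ∩ BCᶜ) Tb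
    have h2 := ClusterCovTransfer.real_eq_inter_add_inter_compl w (Sbᶜ ∩ Scᶜ ∩ BCᶜ ∩ Tbᶜ) Tc
    have e1 : Sbᶜ ∩ Scᶜ ∩ BCᶜ ∩ Tbᶜ ∩ Tcᶜ = (Tb ∪ Sb)ᶜ ∩ (Tc ∪ Sc)ᶜ ∩ BCᶜ := by
      ext ω; simp only [mem_inter_iff, mem_compl_iff, mem_union]; tauto
    have e2 : Sbᶜ ∩ Scᶜ ∩ BCᶜ ∩ Tbᶜ ∩ Tc = Sbᶜ ∩ Scᶜ ∩ BCᶜ ∩ Tc := by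
      ext ω
      simp only [mem_inter_iff, mem_compl_iff]
      constructor
      · rintro ⟨⟨h, _⟩, htc⟩; exact ⟨h, htc⟩
      · rintro ⟨h, htc⟩
        refine ⟨⟨h, fun htb => notConn_tb_tc t b c ω h.2 htb htc⟩, htc⟩
    rw [← e1]; rw [e2] at h2; rw [← hμ] at h1 h2; linarith
  -- (ii) the BHK rows
  have rb := rowPi_b_cov w S t b c
  have rc' := rowPi_b_cov w S t c b
  rw [openConn_symm c b] at rc'
  rw [← hμ, ← hSb, ← hSc, ← hBC] at rb rc'
  change μ.real (Sbᶜ ∩ BCᶜ) * μ.real (Sbᶜ ∩ BCᶜ ∩ ((openConn b t : Set (BondConfig V)) ∩ Sc)) ≤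
    μ.real (Sbᶜ ∩ BCᶜ ∩ (openConn b t : Set (BondConfig V))) * μ.real (Sbᶜ ∩ BCᶜ ∩ Sc) at rb
  change μ.real (Scᶜ ∩ BCᶜ) * μ.real (Scᶜ ∩ BCᶜ ∩ ((openConn c t : Set (BondConfig V)) ∩ Sb)) ≤
    μ.real (Scᶜ ∩ BCᶜ ∩ (openConn c t : Set (BondConfig V))) * μ.real (Scᶜ ∩ BCᶜ ∩ Sb) at rc'
  rw [openConn_symm b t, ← hTb] at rb
  rw [openConn_symm c t, ← hTc] at rc'
  -- bookkeeping for the b-row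
  have qb1 : μ.real (Sbᶜ ∩ BCᶜ ∩ Sc) = B0 - U0 := by
    have h := ClusterCovTransfer.real_eq_inter_add_inter_compl w (Sbᶜ ∩ BCᶜ) Sc
    have e : Sbᶜ ∩ BCᶜ ∩ Scᶜ = Sbᶜ ∩ Scᶜ ∩ BCᶜ := by
      ext ω; simp only [mem_inter_iff, mem_compl_iff]; tauto
    rw [e] at h; rw [← hμ] at h; linarith
  have qb2 : μ.real (Sbᶜ ∩ BCᶜ ∩ (Tb ∩ Sc)) = μ.real (Sbᶜ ∩ BCᶜ ∩ Tb) - mb := by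
    have h := ClusterCovTransfer.real_eq_inter_add_inter_compl w (Sbᶜ ∩ BCᶜ ∩ Tb) Sc
    have e1 : Sbᶜ ∩ BCᶜ ∩ Tb ∩ Sc = Sbᶜ ∩ BCᶜ ∩ (Tb ∩ Sc) := by
      ext ω; simp only [mem_inter_iff]; tauto
    have e2 : Sbᶜ ∩ BCᶜ ∩ Tb ∩ Scᶜ = Sbᶜ ∩ Scᶜ ∩ BCᶜ ∩ Tb := by
      ext ω; simp only [mem_inter_iff, mem_compl_iff]; tauto
    rw [e1, e2] at h; rw [← hμ] at h; linarith
  have qc1 : μ.real (Scᶜ ∩ BCᶜ ∩ Sb) = C0 - U0 := by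
    have h := ClusterCovTransfer.real_eq_inter_add_inter_compl w (Scᶜ ∩ BCᶜ) Sb
    have e : Scᶜ ∩ BCᶜ ∩ Sbᶜ = Sbᶜ ∩ Scᶜ ∩ BCᶜ := by
      ext ω; simp only [mem_inter_iff, mem_compl_iff]; tauto
    rw [e] at h; rw [← hμ] at h; linarith
  have qc2 : μ.real (Scᶜ ∩ BCᶜ ∩ (Tc ∩ Sb)) = μ.real (Scᶜ ∩ BCᶜ ∩ Tc) - mc := by
    have h := ClusterCovTransfer.real_eq_inter_add_inter_compl w (Scᶜ ∩ BCᶜ ∩ Tc) Sb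
    have e1 : Scᶜ ∩ BCᶜ ∩ Tc ∩ Sb = Scᶜ ∩ BCᶜ ∩ (Tc ∩ Sb) := by
      ext ω; simp only [mem_inter_iff]; tauto
    have e2 : Scᶜ ∩ BCᶜ ∩ Tc ∩ Sbᶜ = Sbᶜ ∩ Scᶜ ∩ BCᶜ ∩ Tc := by
      ext ω; simp only [mem_inter_iff, mem_compl_iff]; tauto
    rw [e1, e2] at h; rw [← hμ] at h; linarith
  rw [qb1, qb2] at rb
  rw [qc1, qc2] at rc'
  -- `U0·(B0−B1) ≤ B0·mb` and `U0·(C0−C1) ≤ C0·mc`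
  set pb := μ.real (Sbᶜ ∩ BCᶜ ∩ Tb) with hpb
  set pc := μ.real (Scᶜ ∩ BCᶜ ∩ Tc) with hpc
  have ineq_b : U0 * pb ≤ B0 * mb := by nlinarith [rb]
  have ineq_c : U0 * pc ≤ C0 * mc := by nlinarith [rc']
  have hB0 : 0 ≤ B0 := measureReal_nonneg
  have hC0 : 0 ≤ C0 := measureReal_nonneg
  rw [dB, dC, dU]
  have e1 : U0 * ((B0 - (B0 - pb)) * C0 + (C0 - (C0 - pc)) * B0) = C0 * (U0 * pb) + B0 * (U0 * pc) := by ring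
  have e2 : (U0 - (U0 - mb - mc)) * B0 * C0 = C0 * (B0 * mb) + B0 * (C0 * mc) := by ring
  rw [e1, e2]
  exact add_le_add (mul_le_mul_of_nonneg_left ineq_b hC0) (mul_le_mul_of_nonneg_left ineq_c hB0)


end APL

end Summit.CriticalPhenomena.PercolationContinuityZ3.Theorems

end
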